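import Mathlib.Topology.Order.IntermediateValue
import Mathlib.Topology.UniformSpace.HeineCantor
import Mathlib.Topology.MetricSpace.Pseudo.Lemmas
import Mathlib.Analysis.Normed.Order.Lattice
import Mathlib.Topology.Algebra.Order.Field
import HarnessLib

/-!
# Tame real functions on an interval: piecewise monotone approximation

Topic: a `C⁰` substitute for Morse functions of one variable, used to put the `1`-skeleton of a
disc in general position with respect to a `C⁰` codimension-one foliation
(`TautFoliations*.lean`: along an edge mapped into a flow box, the transverse coordinate is
replaced by a nearby *tame* function; tameness — unlike piecewise linearity — is preserved by
the `C⁰` changes of transverse coordinate, which are local homeomorphisms of `ℝ`). A real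
function is **tame** at a point, on one side, if on a small closed interval on that side it is
strictly increasing, strictly decreasing or constant; it is tame on `[a, b]` if it is
continuous there and tame on the right at every point of `[a, b)` and on the left at every
point of `(a, b]`. This is the structure of the critical points of a generic smooth function
(finitely many local extrema, monotone in between) kept in purely topological terms
(Camacho–Lins Neto, *Geometric Theory of Foliations*, Ch. VI §2, Lemma 1: approximation by
Morse functions keeping the values near the boundary; here in dimension one and class `C⁰`).

* `IsTameRight f x`, `IsTameLeft f x`, `IsTameOn f a b` (**definitions**).
* **Affine functions and piecewise affine gluings are tame** (`isTameOn_affine`,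
  `IsTameOn.glue`).
* **Tame approximation with fixed end values** (`exists_isTameOn_approx`): every function
  continuous on `[a, b]` is uniformly approximated on `[a, b]` by tame functions with the same
  values at `a` and `b` (piecewise affine interpolation on a fine uniform partition; uniform
  continuity).
* **Invariance** (`IsTameRight.comp_of_strictMonoOn`, `…_of_strictAntiOn`, and the left
  versions): post-composition with a function continuous and strictly monotone near the value
  preserves tameness at a point — so tameness of a transverse coordinate along a curve does not
  depend on the flow box used to measure it.

## References

* C. Camacho, A. Lins Neto, *Geometric Theory of Foliations*, Birkhäuser (1985), Ch. VI §2,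
  Lemma 1; §3, Prop. 1 [CamachoLinsNeto1985].

## Design notes

* Pure real analysis (Mathlib only). Functions are total `ℝ → ℝ`; all statements are relative
  to `[a, b]` or to one-sided closed intervals `[x, x + δ]`, `[x - δ, x]`.
-/
open Set Filter Topology

namespace Literature.Topology.FourManifolds

namespace TameFunction

-- BODY
/-! ## One-sided tameness -/

/-- `f` is **tame on the right at `x`**: on some interval `[x, x + δ]`, `δ > 0`, it is strictly
increasing, strictly decreasing, or constant. [folklore] -/
def IsTameRight (f : ℝ → ℝ) (x : ℝ) : Prop :=
  ∃ δ > (0 : ℝ), StrictMonoOn f (Icc x (x + δ)) ∨ StrictAntiOn f (Icc x (x + δ)) ∨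
    ∀ y ∈ Icc x (x + δ), f y = f x

/-- `f` is **tame on the left at `x`**: on some interval `[x - δ, x]`, `δ > 0`, it is strictly
increasing, strictly decreasing, or constant. [folklore] -/
def IsTameLeft (f : ℝ → ℝ) (x : ℝ) : Prop :=
  ∃ δ > (0 : ℝ), StrictMonoOn f (Icc (x - δ) x) ∨ StrictAntiOn f (Icc (x - δ) x) ∨
    ∀ y ∈ Icc (x - δ) x, f y = f x

/-- `f` is **tame on `[a, b]`**: continuous on `[a, b]`, tame on the right at every point of
`[a, b)` and on the left at every point of `(a, b]`. [folklore] -/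
def IsTameOn (f : ℝ → ℝ) (a b : ℝ) : Prop :=
  ContinuousOn f (Icc a b) ∧ (∀ x ∈ Ico a b, IsTameRight f x) ∧ ∀ x ∈ Ioc a b, IsTameLeft f x

variable {f g : ℝ → ℝ} {a b c x : ℝ}

/-- Shrinking the interval of right tameness. [folklore] -/
theorem IsTameRight.of_le (h : IsTameRight f x) : ∃ δ₀ > (0 : ℝ), ∀ δ, 0 < δ → δ ≤ δ₀ →
    StrictMonoOn f (Icc x (x + δ)) ∨ StrictAntiOn f (Icc x (x + δ)) ∨ ∀ y ∈ Icc x (x + δ), f y = f x := by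
  obtain ⟨δ₀, hδ₀, h⟩ := h
  refine ⟨δ₀, hδ₀, fun δ _ hδ ↦ ?_⟩
  have hsub : Icc x (x + δ) ⊆ Icc x (x + δ₀) := Icc_subset_Icc le_rfl (by linarith)
  rcases h with h | h | h
  · exact Or.inl (h.mono hsub)
  · exact Or.inr (Or.inl (h.mono hsub))
  · exact Or.inr (Or.inr fun y hy ↦ h y (hsub hy))

/-- Shrinking the interval of left tameness. [folklore] -/
theorem IsTameLeft.of_le (h : IsTameLeft f x) : ∃ δ₀ > (0 : ℝ), ∀ δ, 0 < δ → δ ≤ δ₀ →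
    StrictMonoOn f (Icc (x - δ) x) ∨ StrictAntiOn f (Icc (x - δ) x) ∨ ∀ y ∈ Icc (x - δ) x, f y = f x := by
  obtain ⟨δ₀, hδ₀, h⟩ := h
  refine ⟨δ₀, hδ₀, fun δ _ hδ ↦ ?_⟩
  have hsub : Icc (x - δ) x ⊆ Icc (x - δ₀) x := Icc_subset_Icc (by linarith) le_rfl
  rcases h with h | h | h
  · exact Or.inl (h.mono hsub)
  · exact Or.inr (Or.inl (h.mono hsub))
  · exact Or.inr (Or.inr fun y hy ↦ h y (hsub hy))

/-- Right tameness depends only on the values on a right neighbourhood. [folklore] -/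
theorem IsTameRight.congr (h : IsTameRight f x) {δ₁ : ℝ} (hδ₁ : 0 < δ₁)
    (heq : EqOn f g (Icc x (x + δ₁))) : IsTameRight g x := by
  obtain ⟨δ₀, hδ₀, h⟩ := h.of_le
  have hsub : Icc x (x + min δ₀ δ₁) ⊆ Icc x (x + δ₁) :=
    Icc_subset_Icc le_rfl (by linarith [min_le_right δ₀ δ₁])
  refine ⟨min δ₀ δ₁, lt_min hδ₀ hδ₁, ?_⟩
  rcases h (min δ₀ δ₁) (lt_min hδ₀ hδ₁) (min_le_left _ _) with h | h | h
  · exact Or.inl (h.congr (heq.mono hsub))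
  · exact Or.inr (Or.inl (h.congr (heq.mono hsub)))
  · refine Or.inr (Or.inr fun y hy ↦ ?_)
    rw [← heq (hsub hy), ← heq (hsub (left_mem_Icc.2 (by linarith [lt_min hδ₀ hδ₁])))]
    exact h y hy

/-- Left tameness depends only on the values on a left neighbourhood. [folklore] -/
theorem IsTameLeft.congr (h : IsTameLeft f x) {δ₁ : ℝ} (hδ₁ : 0 < δ₁)
    (heq : EqOn f g (Icc (x - δ₁) x)) : IsTameLeft g x := by
  obtain ⟨δ₀, hδ₀, h⟩ := h.of_le
  have hsub : Icc (x - min δ₀ δ₁) x ⊆ Icc (x - δ₁) x :=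
    Icc_subset_Icc (by linarith [min_le_right δ₀ δ₁]) le_rfl
  refine ⟨min δ₀ δ₁, lt_min hδ₀ hδ₁, ?_⟩
  rcases h (min δ₀ δ₁) (lt_min hδ₀ hδ₁) (min_le_left _ _) with h | h | h
  · exact Or.inl (h.congr (heq.mono hsub))
  · exact Or.inr (Or.inl (h.congr (heq.mono hsub)))
  · refine Or.inr (Or.inr fun y hy ↦ ?_)
    rw [← heq (hsub hy), ← heq (hsub (right_mem_Icc.2 (by linarith [lt_min hδ₀ hδ₁])))]
    exact h y hy

/-! ## Affine functions are tame -/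

/-- An affine function `y ↦ p + q * y` is tame on the right at every point. [folklore] -/
theorem isTameRight_affine (p q x : ℝ) : IsTameRight (fun y ↦ p + q * y) x := by
  refine ⟨1, one_pos, ?_⟩
  rcases lt_trichotomy q 0 with hq | rfl | hq
  · exact Or.inr (Or.inl fun y₁ _ y₂ _ h ↦ by nlinarith)
  · exact Or.inr (Or.inr fun y _ ↦ by ring)
  · exact Or.inl fun y₁ _ y₂ _ h ↦ by nlinarith

/-- An affine function `y ↦ p + q * y` is tame on the left at every point. [folklore] -/
theorem isTameLeft_affine (p q x : ℝ) : IsTameLeft (fun y ↦ p + q * y) x := by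
  refine ⟨1, one_pos, ?_⟩
  rcases lt_trichotomy q 0 with hq | rfl | hq
  · exact Or.inr (Or.inl fun y₁ _ y₂ _ h ↦ by nlinarith)
  · exact Or.inr (Or.inr fun y _ ↦ by ring)
  · exact Or.inl fun y₁ _ y₂ _ h ↦ by nlinarith

/-- An affine function is tame on every interval. [folklore] -/
theorem isTameOn_affine (p q a b : ℝ) : IsTameOn (fun y ↦ p + q * y) a b :=
  ⟨by fun_prop, fun x _ ↦ isTameRight_affine p q x, fun x _ ↦ isTameLeft_affine p q x⟩

/-! ## Gluing tame functions -/

/-- **Gluing**: if `f` is tame on `[a, b]`, `g` is tame on `[b, c]` and `f b = g b`, then the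
function equal to `f` on `(-∞, b]` and to `g` on `(b, ∞)` is tame on `[a, c]`. [folklore] -/
theorem IsTameOn.glue (hf : IsTameOn f a b) (hg : IsTameOn g b c) (hab : a ≤ b) (hbc : b ≤ c)
    (hfg : f b = g b) : IsTameOn (fun y ↦ if y ≤ b then f y else g y) a c := by
  set h : ℝ → ℝ := fun y ↦ if y ≤ b then f y else g y with hh
  have hl : ∀ y, y ≤ b → h y = f y := fun y hy ↦ by simp [hh, hy]
  have hr : ∀ y, b ≤ y → h y = g y := fun y hy ↦ by
    by_cases hyb : y ≤ b
    · have : y = b := le_antisymm hyb hy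
      simp [hh, this, hfg]
    · simp [hh, hyb]
  refine ⟨?_, fun x hx ↦ ?_, fun x hx ↦ ?_⟩
  · have h₁ : ContinuousOn h (Icc a b) := hf.1.congr fun y hy ↦ hl y hy.2
    have h₂ : ContinuousOn h (Icc b c) := hg.1.congr fun y hy ↦ hr y hy.1
    rw [← Icc_union_Icc_eq_Icc hab hbc]
    exact h₁.union_of_isClosed h₂ isClosed_Icc isClosed_Icc
  · -- right tameness at `x ∈ [a, c)`
    rcases lt_or_ge x b with hxb | hxb
    · exact (hf.2.1 x ⟨hx.1, hxb⟩).congr (sub_pos.2 hxb) fun y hy ↦ (hl y (by linarith [hy.2])).symm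
    · have hxc : x < c := hx.2
      exact (hg.2.1 x ⟨hxb, hxc⟩).congr (sub_pos.2 hxc) fun y hy ↦ (hr y (hxb.trans hy.1)).symm
  · -- left tameness at `x ∈ (a, c]`
    rcases le_or_gt x b with hxb | hxb
    · exact (hf.2.2 x ⟨hx.1, hxb⟩).congr (sub_pos.2 hx.1) fun y hy ↦ (hl y (hy.2.trans hxb)).symm
    · exact (hg.2.2 x ⟨hxb, hx.2⟩).congr (sub_pos.2 hxb) fun y hy ↦ (hr y (by linarith [hy.1])).symm

/-- A function equal on `[a, b]` to a function tame on `[a, b]` is tame on `[a, b]`, provided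
`a < b` (the one-sided intervals can be taken inside `[a, b]`). [folklore] -/
theorem IsTameOn.congr (hf : IsTameOn f a b) (heq : EqOn f g (Icc a b)) : IsTameOn g a b := by
  refine ⟨hf.1.congr fun y hy ↦ (heq hy).symm, fun x hx ↦ ?_, fun x hx ↦ ?_⟩
  · exact (hf.2.1 x hx).congr (sub_pos.2 hx.2) (heq.mono (Icc_subset_Icc hx.1 (by linarith)))
  · exact (hf.2.2 x hx).congr (sub_pos.2 hx.1) (heq.mono (Icc_subset_Icc (by linarith) hx.2))

/-! ## Tame approximation with fixed end values -/

/-- **Affine interpolation error**: if `|f s - f x| < ε` and `|f s' - f x| < ε` then every convex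
combination `(1 - λ) f s + λ f s'`, `λ ∈ [0, 1]`, is within `ε` of `f x`. [folklore] -/
theorem abs_convexComb_sub_lt {u v w ε lam : ℝ} (hu : |u - w| < ε) (hv : |v - w| < ε)
    (h₀ : 0 ≤ lam) (h₁ : lam ≤ 1) : |(1 - lam) * u + lam * v - w| < ε := by
  have : (1 - lam) * u + lam * v - w = (1 - lam) * (u - w) + lam * (v - w) := by ring
  rw [this]
  rcases h₀.eq_or_lt with rfl | h₀'
  · simpa using hu
  rcases h₁.eq_or_lt with rfl | h₁'
  · simpa using hv
  calc |(1 - lam) * (u - w) + lam * (v - w)| ≤ |(1 - lam) * (u - w)| + |lam * (v - w)| :=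
        abs_add_le _ _
    _ = (1 - lam) * |u - w| + lam * |v - w| := by
        rw [abs_mul, abs_mul, abs_of_nonneg (by linarith), abs_of_nonneg h₀]
    _ < (1 - lam) * ε + lam * ε := by
        gcongr ?_ + ?_
        · exact mul_lt_mul_of_pos_left hu (by linarith)
        · exact mul_lt_mul_of_pos_left hv h₀'
    _ = ε := by ring

/-- **Tame approximation of continuous functions with fixed end values.** A function continuous
on `[a, b]` is uniformly approximated on `[a, b]`, within any `ε > 0`, by a function tame on
`[a, b]` with the same values at `a` and at `b`: the piecewise affine interpolation of `f` on
a uniform partition of mesh smaller than a modulus of uniform continuity of `f` for `ε`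
(Camacho–Lins Neto, Ch. VI §2, Lemma 1, in dimension one and class `C⁰`).
[cite: CamachoLinsNeto1985, Ch. VI §2 Lemma 1] -/
theorem exists_isTameOn_approx (hab : a ≤ b) (hf : ContinuousOn f (Icc a b)) {ε : ℝ} (hε : 0 < ε) :
    ∃ g : ℝ → ℝ, IsTameOn g a b ∧ g a = f a ∧ g b = f b ∧ ∀ x ∈ Icc a b, |g x - f x| < ε := by
  -- uniform continuity of `f` on `[a, b]`
  obtain ⟨δ, hδ, hδf⟩ := Metric.uniformContinuousOn_iff.1
    (isCompact_Icc.uniformContinuousOn_of_continuous hf) ε hε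
  -- a number of pieces with mesh `< δ`
  obtain ⟨n, hn⟩ := exists_nat_gt ((b - a) / δ)
  have hn₀ : 0 < (n : ℝ) := lt_of_le_of_lt (div_nonneg (sub_nonneg.2 hab) hδ.le) hn
  set m : ℝ := (b - a) / n with hm
  have hm₀ : 0 ≤ m := div_nonneg (sub_nonneg.2 hab) hn₀.le
  have hmδ : m < δ := by
    rw [hm, div_lt_iff₀ hn₀]
    calc b - a = (b - a) / δ * δ := by field_simp
      _ < n * δ := mul_lt_mul_of_pos_right hn hδ
      _ = δ * n := mul_comm _ _
  -- nodes
  set s : ℕ → ℝ := fun k ↦ a + k * m with hs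
  have hs₀ : s 0 = a := by simp [hs]
  have hsucc : ∀ k, s (k + 1) = s k + m := fun k ↦ by simp only [hs]; push_cast; ring
  have hsn : s n = b := by
    simp only [hs, hm]
    field_simp
    ring
  have hsmono : ∀ k, s k ≤ s (k + 1) := fun k ↦ by rw [hsucc]; linarith
  have hska : ∀ k, a ≤ s k := fun k ↦ by
    simp only [hs]
    nlinarith [hm₀, (Nat.cast_nonneg k : (0 : ℝ) ≤ k)]
  have hskb : ∀ k, k ≤ n → s k ≤ b := fun k hk ↦ by
    rw [← hsn]
    simp only [hs]
    have : (k : ℝ) ≤ n := by exact_mod_cast hk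
    nlinarith [hm₀]
  -- induction on the number of pieces
  have main : ∀ k, k ≤ n → ∃ g : ℝ → ℝ, IsTameOn g a (s k) ∧ g a = f a ∧ g (s k) = f (s k) ∧
      ∀ x ∈ Icc a (s k), |g x - f x| < ε := by
    intro k
    induction k with
    | zero =>
      intro
      refine ⟨fun _ ↦ f a, ?_, rfl, by rw [hs₀], fun x hx ↦ ?_⟩
      · simpa using isTameOn_affine (f a) 0 a (s 0)
      · rw [hs₀] at hx
        have : x = a := le_antisymm hx.2 hx.1
        simp [this, hε]
    | succ k ih =>
      intro hk
      obtain ⟨g, hg, hga, hgk, hgε⟩ := ih (Nat.le_of_succ_le hk)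
      -- the affine piece on `[s k, s (k+1)]`
      rcases hm₀.eq_or_lt with hm0 | hmpos
      · -- degenerate mesh: all nodes coincide
        have hss : s (k + 1) = s k := by rw [hsucc, ← hm0, add_zero]
        refine ⟨g, by rwa [hss], hga, by rw [hss, hgk], by rw [hss]; exact hgε⟩
      set q : ℝ := (f (s (k + 1)) - f (s k)) / m with hq
      set L : ℝ → ℝ := fun y ↦ (f (s k) - q * s k) + q * y with hL
      have hLk : L (s k) = f (s k) := by simp only [hL]; ring
      have hLk1 : L (s (k + 1)) = f (s (k + 1)) := by
        simp only [hL, hq, hsucc]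
        field_simp
        ring
      refine ⟨fun y ↦ if y ≤ s k then g y else L y, ?_, ?_, ?_, fun x hx ↦ ?_⟩
      · exact hg.glue ((isTameOn_affine _ q _ _).congr fun _ _ ↦ rfl) (hska k) (hsmono k)
          (hgk.trans hLk.symm)
      · simp [hska k, hga]
      · have : ¬ s (k + 1) ≤ s k := by rw [hsucc]; linarith
        simp [this, hLk1]
      · by_cases hxk : x ≤ s k
        · simp only [if_pos hxk]
          exact hgε x ⟨hx.1, hxk⟩
        · simp only [if_neg hxk]
          push Not at hxk
          -- `x = (1 - λ) s k + λ s (k+1)` and `L x = (1 - λ) f (s k) + λ f (s (k+1))`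
          set lam : ℝ := (x - s k) / m with hlam
          have hlam₀ : 0 ≤ lam := div_nonneg (by linarith) hm₀
          have hlam₁ : lam ≤ 1 := by
            rw [hlam, div_le_one hmpos]
            have := hx.2
            rw [hsucc] at this
            linarith
          have hLx : L x = (1 - lam) * f (s k) + lam * f (s (k + 1)) := by
            simp only [hL, hq, hlam]
            field_simp
            ring
          rw [hLx]
          have hxb : x ∈ Icc a b := ⟨hx.1, hx.2.trans (hskb (k + 1) hk)⟩
          have hk' : s k ∈ Icc a b := ⟨hska k, hskb k (Nat.le_of_succ_le hk)⟩
          have hk1' : s (k + 1) ∈ Icc a b := ⟨hska (k + 1), hskb (k + 1) hk⟩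
          refine abs_convexComb_sub_lt ?_ ?_ hlam₀ hlam₁
          · have hd : dist (s k) x < δ := by
              rw [Real.dist_eq, abs_sub_comm, abs_of_nonneg (by linarith)]
              have := hx.2
              rw [hsucc] at this
              linarith
            have := hδf (s k) hk' x hxb hd
            rwa [Real.dist_eq] at this
          · have hd : dist (s (k + 1)) x < δ := by
              rw [Real.dist_eq, abs_of_nonneg (by linarith [hx.2])]
              rw [hsucc]
              linarith
            have := hδf (s (k + 1)) hk1' x hxb hd
            rwa [Real.dist_eq] at this
  obtain ⟨g, hg, hga, hgb, hgε⟩ := main n le_rfl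
  rw [hsn] at hg hgb hgε
  exact ⟨g, hg, hga, hgb, hgε⟩

/-! ## Invariance under monotone changes of the value coordinate -/

/-- A right-continuous function maps a small right interval into a given neighbourhood of its
value. [folklore] -/
theorem exists_mapsTo_Icc_right (hfc : ContinuousWithinAt f (Ici x) x) {s : Set ℝ} (hs : s ∈ 𝓝 (f x)) :
    ∃ δ > (0 : ℝ), MapsTo f (Icc x (x + δ)) s := by
  obtain ⟨u, hxu, hu⟩ := mem_nhdsGE_iff_exists_Icc_subset.1 (hfc hs)
  exact ⟨u - x, sub_pos.2 hxu, fun y hy ↦ hu ⟨hy.1, by linarith [hy.2]⟩⟩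

/-- A left-continuous function maps a small left interval into a given neighbourhood of its
value. [folklore] -/
theorem exists_mapsTo_Icc_left (hfc : ContinuousWithinAt f (Iic x) x) {s : Set ℝ} (hs : s ∈ 𝓝 (f x)) :
    ∃ δ > (0 : ℝ), MapsTo f (Icc (x - δ) x) s := by
  obtain ⟨l, hlx, hl⟩ := mem_nhdsLE_iff_exists_Icc_subset.1 (hfc hs)
  exact ⟨x - l, sub_pos.2 hlx, fun y hy ↦ hl ⟨by linarith [hy.1], hy.2⟩⟩

/-- **Tameness is preserved by increasing changes of the value coordinate** (right version):
if `f` is tame on the right and right-continuous at `x`, and `γ` is strictly increasing on a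
neighbourhood of `f x`, then `γ ∘ f` is tame on the right at `x`. [folklore] -/
theorem IsTameRight.comp_of_strictMonoOn (h : IsTameRight f x) (hfc : ContinuousWithinAt f (Ici x) x)
    {γ : ℝ → ℝ} {s : Set ℝ} (hs : s ∈ 𝓝 (f x)) (hγ : StrictMonoOn γ s) : IsTameRight (γ ∘ f) x := by
  obtain ⟨δ₀, hδ₀, h⟩ := h.of_le
  obtain ⟨δ₁, hδ₁, hmaps⟩ := exists_mapsTo_Icc_right hfc hs
  have hmaps' : MapsTo f (Icc x (x + min δ₀ δ₁)) s :=
    hmaps.mono_left (Icc_subset_Icc le_rfl (by linarith [min_le_right δ₀ δ₁]))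
  refine ⟨min δ₀ δ₁, lt_min hδ₀ hδ₁, ?_⟩
  rcases h _ (lt_min hδ₀ hδ₁) (min_le_left _ _) with h | h | h
  · exact Or.inl (hγ.comp h hmaps')
  · exact Or.inr (Or.inl (hγ.comp_strictAntiOn h hmaps'))
  · exact Or.inr (Or.inr fun y hy ↦ by simp only [Function.comp_apply, h y hy])

/-- **Tameness is preserved by decreasing changes of the value coordinate** (right version).
[folklore] -/
theorem IsTameRight.comp_of_strictAntiOn (h : IsTameRight f x) (hfc : ContinuousWithinAt f (Ici x) x)
    {γ : ℝ → ℝ} {s : Set ℝ} (hs : s ∈ 𝓝 (f x)) (hγ : StrictAntiOn γ s) : IsTameRight (γ ∘ f) x := by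
  obtain ⟨δ₀, hδ₀, h⟩ := h.of_le
  obtain ⟨δ₁, hδ₁, hmaps⟩ := exists_mapsTo_Icc_right hfc hs
  have hmaps' : MapsTo f (Icc x (x + min δ₀ δ₁)) s :=
    hmaps.mono_left (Icc_subset_Icc le_rfl (by linarith [min_le_right δ₀ δ₁]))
  refine ⟨min δ₀ δ₁, lt_min hδ₀ hδ₁, ?_⟩
  rcases h _ (lt_min hδ₀ hδ₁) (min_le_left _ _) with h | h | h
  · exact Or.inr (Or.inl (hγ.comp_strictMonoOn h hmaps'))
  · exact Or.inl (hγ.comp h hmaps')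
  · exact Or.inr (Or.inr fun y hy ↦ by simp only [Function.comp_apply, h y hy])

/-- **Tameness is preserved by increasing changes of the value coordinate** (left version).
[folklore] -/
theorem IsTameLeft.comp_of_strictMonoOn (h : IsTameLeft f x) (hfc : ContinuousWithinAt f (Iic x) x)
    {γ : ℝ → ℝ} {s : Set ℝ} (hs : s ∈ 𝓝 (f x)) (hγ : StrictMonoOn γ s) : IsTameLeft (γ ∘ f) x := by
  obtain ⟨δ₀, hδ₀, h⟩ := h.of_le
  obtain ⟨δ₁, hδ₁, hmaps⟩ := exists_mapsTo_Icc_left hfc hs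
  have hmaps' : MapsTo f (Icc (x - min δ₀ δ₁) x) s :=
    hmaps.mono_left (Icc_subset_Icc (by linarith [min_le_right δ₀ δ₁]) le_rfl)
  refine ⟨min δ₀ δ₁, lt_min hδ₀ hδ₁, ?_⟩
  rcases h _ (lt_min hδ₀ hδ₁) (min_le_left _ _) with h | h | h
  · exact Or.inl (hγ.comp h hmaps')
  · exact Or.inr (Or.inl (hγ.comp_strictAntiOn h hmaps'))
  · exact Or.inr (Or.inr fun y hy ↦ by simp only [Function.comp_apply, h y hy])

/-- **Tameness is preserved by decreasing changes of the value coordinate** (left version).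
[folklore] -/
theorem IsTameLeft.comp_of_strictAntiOn (h : IsTameLeft f x) (hfc : ContinuousWithinAt f (Iic x) x)
    {γ : ℝ → ℝ} {s : Set ℝ} (hs : s ∈ 𝓝 (f x)) (hγ : StrictAntiOn γ s) : IsTameLeft (γ ∘ f) x := by
  obtain ⟨δ₀, hδ₀, h⟩ := h.of_le
  obtain ⟨δ₁, hδ₁, hmaps⟩ := exists_mapsTo_Icc_left hfc hs
  have hmaps' : MapsTo f (Icc (x - min δ₀ δ₁) x) s :=
    hmaps.mono_left (Icc_subset_Icc (by linarith [min_le_right δ₀ δ₁]) le_rfl)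
  refine ⟨min δ₀ δ₁, lt_min hδ₀ hδ₁, ?_⟩
  rcases h _ (lt_min hδ₀ hδ₁) (min_le_left _ _) with h | h | h
  · exact Or.inr (Or.inl (hγ.comp_strictMonoOn h hmaps'))
  · exact Or.inl (hγ.comp h hmaps')
  · exact Or.inr (Or.inr fun y hy ↦ by simp only [Function.comp_apply, h y hy])

end TameFunction

end Literature.Topology.FourManifolds
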